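import Summits.AtomisticToContinuum.HydrodynamicLimit.Theorems.OneFlightGossipEngineEnergyCurrentTailsLevelCensusClosureMerge
import Summits.AtomisticToContinuum.HydrodynamicLimit.Theorems.OneFlightGossipEngineEnergyCurrentTailsLevelCensusClosureSpallation
import HarnessLib

/-!
# Census closure, arithmetic core IV: the supersolution inequality
# (stub C of the line `level-census-comparison`, crux `EnergyCurrentTails`, stmt-AtomisticToContinuum-9235)

Fourth and last measure-free file behind the registered stub `stub_censusClosure` (helper file of
the line lead's seat c2; registered main theorem `census_supersolution`, the lead's abstract form of
C2; also the registered pair-majorant bound `census_pairSum_le` = merge sum + spallation sum).  At a level `E ∈ [E₀, Etop]`, for an abstract census majorant `nhi` (sup over a short time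
window of the expected level census: `0 ≤ nhi ≤ M`, Chebyshev `nhi E' ≤ M m₂/E'`, `nhi ≤ b + δ₀` on
`[E₀, Etop]`, `nhi ≤ b` above `Etop`) and a census value `nE ≥ b(E) − δ₀` at the touching level,
the four fluxes of the crossing ledger compare as
`band C₁√E (nhi(E−Δ) − nE) + pairs (A√E/M)(merge + spallation sums) + tail C₁ ∑_k √(2^{k+1}4E)
nhi(2^k 4E) ≤ decay c√E (nE − nhi(3E/2))`, provided the constants are chosen in the order
`L ≥ 4`, `(A + C₁)e^{−L} ≤ c/200`; `R ≥ max(8, 8L, 20C₁(L+4)/c)`; `Δ ≥ max(m₂, 10A(96e^{L}+24)Rm₂/c)`;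
`E₀ = RΔ`; `δ₀ · Q(Etop) ≤ (c/2)√E₀ b(Etop)` (budget: band `c/10`, pairs `c/10 + c/50`, tail `c/400`,
slack `c/2`, against decay `≥ 9c/10`, all relative to `√E b(E)`).  Stub C instantiates it with
`M = N + 1`, the window sup/inf of `(levelCensus …).toReal`, and the flux inequalities of stubs
A, F1, F2, F3.

References: Gamba–Panferov–Villani 2009 (ARMA 194), the comparison principle for Maxwellian-weighted
bounds, transplanted to an expected census.
-/

noncomputable section

open Real Finset

namespace Summit.AtomisticToContinuum.HydrodynamicLimit.Theorems.EnergyCurrentTailsLevelCensus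

/-! ## The supersolution inequality (assembly) -/

section Core

/-- `√(4E) = 2√E`. -/
theorem sqrt_four_mul (E : ℝ) : Real.sqrt (4 * E) = 2 * Real.sqrt E := by
  rw [Real.sqrt_mul (by norm_num : (0 : ℝ) ≤ 4), show (4 : ℝ) = 2 ^ 2 by norm_num,
    Real.sqrt_sq (by norm_num : (0 : ℝ) ≤ 2)]

/-- **The pair majorant** (`∀`-form; registered helper `census_pairSum_le`): for `E ≥ E₀ = RΔ`
(`R ≥ 8`, `8L ≤ R`, `m₂ ≤ Δ`) the merge and spallation sums together are at most
`((96 e^{L} + 24) R m₂/Δ + 4 e^{−L}) M b(E) + 3Mδ₀ (⌈E/(2Δ)⌉ + ⌈E/Δ⌉ + 1)`. -/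
theorem census_pairSum_le :
    ∀ (M m₂ L Δ E₀ α β δ₀ : ℝ) (R : ℕ) (b nhi : ℝ → ℝ),
      (∀ E, b E = β * M * Real.exp (-(α * E)) / E ^ 2) → 1 ≤ M → 0 < m₂ → 0 ≤ L →
      8 ≤ (R : ℝ) → 8 * L ≤ R → m₂ ≤ Δ → E₀ = R * Δ → α = L / E₀ →
      β = m₂ * Real.exp L * E₀ → (∀ E', 0 ≤ nhi E') → (∀ E', nhi E' ≤ M) →
      (∀ E', 0 < E' → nhi E' ≤ M * m₂ / E') → (∀ E', E₀ ≤ E' → nhi E' ≤ b E' + δ₀) →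
      0 ≤ δ₀ → δ₀ ≤ M → ∀ E : ℝ, E₀ ≤ E →
        (∑ k ∈ Finset.Icc 1 ⌈E / (2 * Δ)⌉₊, nhi (E - ((k : ℝ) + 1) * Δ) * nhi ((k : ℝ) * Δ))
          + ∑ j ∈ Finset.range (⌈E / Δ⌉₊ + 1),
              nhi (((j : ℝ) - 1) * Δ) * nhi (2 * E - ((j : ℝ) + 1) * Δ)
        ≤ ((96 * Real.exp L + 24) * R * (m₂ / Δ) + 4 * Real.exp (-L)) * M * b E
          + 3 * M * δ₀ * (⌈E / (2 * Δ)⌉₊ + ⌈E / Δ⌉₊ + 1) := by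
  intro M m₂ L Δ E₀ α β δ₀ R b nhi hb hM hm₂ hL hR8 hRL hΔ hE₀ hα hβ h0 h1 h2 h4 hδ₀ hδM E hE
  have hm := census_mergeSum_le M m₂ L Δ E₀ α β δ₀ R b nhi hb hM hm₂ hL hR8 hRL hΔ hE₀ hα hβ h0
    h2 h4 hδ₀ hδM E hE
  have hs := census_spallSum_le M m₂ L Δ E₀ α β δ₀ R b nhi hb hM hm₂ hL hR8 hRL hΔ hE₀ hα hβ h0
    h1 h2 h4 hδ₀ hδM E hE
  have : ((96 * Real.exp L + 24) * R * (m₂ / Δ) + 4 * Real.exp (-L)) * M * b E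
      + 3 * M * δ₀ * (⌈E / (2 * Δ)⌉₊ + ⌈E / Δ⌉₊ + 1)
      = (96 * Real.exp L * R * M * b E * (m₂ / Δ) + 3 * M * δ₀ * ⌈E / (2 * Δ)⌉₊)
        + (4 * Real.exp (-L) * M * b E + 24 * R * M * b E * (m₂ / Δ)
          + 3 * M * δ₀ * (⌈E / Δ⌉₊ + 1)) := by ring
  rw [this]
  exact add_le_add hm hs

/-- **THE SUPERSOLUTION INEQUALITY of the census closure (registered main theorem of the C2 core,
`∀`-form, measure-free).**  Parameters `M ≥ 1` (`= N+1`), `c, C₁, A, m₂ > 0`; constants in the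
order `L` (`≥ 4`, `(A + C₁)e^{−L} ≤ c/200`), `R` (`≥ 8`, `≥ 8L`, `≥ 20C₁(L+4)/c`), `Δ` (`≥ m₂`,
`≥ 10A(96e^{L}+24)R m₂/c`), `E₀ = RΔ`, `α = L/E₀`, `β = m₂e^{L}E₀`, barrier
`b(E) = βM e^{−αE}/E²`, a top level `Etop ≥ E₀` and a slack `δ₀ ∈ [0, M]` with
`δ₀ · Q(Etop) ≤ (c/2) √E₀ b(Etop)`.  If an abstract census majorant `nhi` satisfies
`0 ≤ nhi ≤ M`, Chebyshev `nhi(E') ≤ M m₂/E'` (`E' > 0`), `nhi ≤ b + δ₀` on `[E₀, Etop]` and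
`nhi ≤ b` above `Etop`, then at every level `E ∈ [E₀, Etop]` and for every value `nE ≥ b(E) − δ₀`
of the census at `E`:
band `C₁√E (nhi(E−Δ) − nE)` + pairs `(A√E/M)(merge sum + spallation sum)` + tail
`C₁ ∑_{k<K} √(2^{k+1}·4E) nhi(2^k·4E)` ≤ decay `c√E (nE − nhi(3E/2))`. -/
theorem census_supersolution :
    ∀ (M c C₁ A m₂ L Δ E₀ α β Etop δ₀ : ℝ) (R : ℕ) (b nhi : ℝ → ℝ),
      1 ≤ M → 0 < c → 0 < C₁ → 0 < A → 0 < m₂ →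
      4 ≤ L → (A + C₁) * Real.exp (-L) ≤ c / 200 →
      8 ≤ (R : ℝ) → 8 * L ≤ R → 20 * C₁ * (L + 4) / c ≤ R →
      m₂ ≤ Δ → 10 * A * (96 * Real.exp L + 24) * R * m₂ / c ≤ Δ →
      E₀ = R * Δ → α = L / E₀ → β = m₂ * Real.exp L * E₀ →
      (∀ E, b E = β * M * Real.exp (-(α * E)) / E ^ 2) →
      E₀ ≤ Etop → 0 ≤ δ₀ → δ₀ ≤ M →
      δ₀ * (2 * C₁ * Real.sqrt Etop
          + 3 * A * Real.sqrt Etop * (⌈Etop / (2 * Δ)⌉₊ + ⌈Etop / Δ⌉₊ + 1)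
          + C₁ * Etop ^ 2 / (2 * E₀ * Real.sqrt E₀) + 2 * c * Real.sqrt Etop)
        ≤ c / 2 * Real.sqrt E₀ * b Etop →
      (∀ E', 0 ≤ nhi E') → (∀ E', nhi E' ≤ M) → (∀ E', 0 < E' → nhi E' ≤ M * m₂ / E') →
      (∀ E', E₀ ≤ E' → E' ≤ Etop → nhi E' ≤ b E' + δ₀) → (∀ E', Etop < E' → nhi E' ≤ b E') →
      ∀ (E nE : ℝ), E₀ ≤ E → E ≤ Etop → b E - δ₀ ≤ nE → ∀ K : ℕ,
        C₁ * Real.sqrt E * (nhi (E - Δ) - nE)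
          + A * Real.sqrt E / M *
              ((∑ k ∈ Finset.Icc 1 ⌈E / (2 * Δ)⌉₊, nhi (E - ((k : ℝ) + 1) * Δ) * nhi ((k : ℝ) * Δ))
                + ∑ j ∈ Finset.range (⌈E / Δ⌉₊ + 1),
                    nhi (((j : ℝ) - 1) * Δ) * nhi (2 * E - ((j : ℝ) + 1) * Δ))
          + C₁ * ∑ k ∈ Finset.range K, Real.sqrt (2 ^ (k + 1) * (4 * E)) * nhi (2 ^ k * (4 * E))
        ≤ c * Real.sqrt E * (nE - nhi (3 / 2 * E)) := by
  intro M c C₁ A m₂ L Δ E₀ α β Etop δ₀ R b nhi hM hc hC₁ hA hm₂ hL hLe hR8 hRL hRc hΔm hΔ hE₀ hα hβ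
    hb hEtop hδ₀ hδM hδQ h0 h1 h2 h4a h4b E nE hE hEt hnE K
  -- bookkeeping
  have hM0 : 0 < M := lt_of_lt_of_le one_pos hM
  have hL0 : 0 ≤ L := by linarith
  have hΔ0 : 0 < Δ := lt_of_lt_of_le hm₂ hΔm
  have hR0 : 0 < (R : ℝ) := by linarith
  have hE₀pos : 0 < E₀ := by rw [hE₀]; positivity
  have hEpos : 0 < E := by linarith
  have hβpos : 0 < β := by rw [hβ]; positivity
  have hαnn : 0 ≤ α := by rw [hα]; positivity
  have hαE₀ : α * E₀ = L := by rw [hα]; field_simp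
  set s : ℝ := Real.sqrt E with hs
  have hs0 : 0 < s := Real.sqrt_pos.2 hEpos
  have hsE : s * s = E := Real.mul_self_sqrt hEpos.le
  have hbE : 0 < b E := barrier_pos hb hβpos hM0 hEpos.ne'
  have hsb : 0 ≤ s * b E := by positivity
  have h4 : ∀ E', E₀ ≤ E' → nhi E' ≤ b E' + δ₀ := by
    intro E' hE'
    by_cases h : E' ≤ Etop
    · exact h4a E' hE' h
    · linarith [h4b E' (not_le.1 h)]
  -- (1) band
  have T1 : C₁ * s * (nhi (E - Δ) - nE) ≤ c / 10 * (s * b E) + δ₀ * (2 * C₁ * s) := by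
    have hband := census_band_le hb hM0 hm₂ hL0 hR8 hRL hΔm hE₀ hα hβ h2 h4 hδ₀ hE
    have hdiff : nhi (E - Δ) - nE ≤ 2 * (L + 4) / R * b E + 2 * δ₀ := by linarith
    have hRc' : C₁ * (2 * (L + 4) / R) ≤ c / 10 := by
      rw [div_le_iff₀ hc] at hRc
      rw [mul_div_assoc', div_le_iff₀ hR0]
      linarith
    have h1' := mul_le_mul_of_nonneg_left hdiff (show 0 ≤ C₁ * s by positivity)
    have h2' := mul_le_mul_of_nonneg_right hRc' hsb
    have h3' : C₁ * s * (2 * (L + 4) / R * b E + 2 * δ₀)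
        = C₁ * (2 * (L + 4) / R) * (s * b E) + δ₀ * (2 * C₁ * s) := by ring
    linarith
  -- (2) pairs
  have T2 : A * s / M *
      ((∑ k ∈ Finset.Icc 1 ⌈E / (2 * Δ)⌉₊, nhi (E - ((k : ℝ) + 1) * Δ) * nhi ((k : ℝ) * Δ))
        + ∑ j ∈ Finset.range (⌈E / Δ⌉₊ + 1),
            nhi (((j : ℝ) - 1) * Δ) * nhi (2 * E - ((j : ℝ) + 1) * Δ))
      ≤ (c / 10 + c / 50) * (s * b E)
        + δ₀ * (3 * A * s * (⌈E / (2 * Δ)⌉₊ + ⌈E / Δ⌉₊ + 1)) := by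
    have hpair := census_pairSum_le M m₂ L Δ E₀ α β δ₀ R b nhi hb hM hm₂ hL0 hR8 hRL hΔm hE₀ hα
      hβ h0 h1 h2 h4 hδ₀ hδM E hE
    have hΔ' : A * ((96 * Real.exp L + 24) * R * (m₂ / Δ)) ≤ c / 10 := by
      rw [div_le_iff₀ hc] at hΔ
      have : A * ((96 * Real.exp L + 24) * R * (m₂ / Δ))
          = (10 * A * (96 * Real.exp L + 24) * R * m₂) / Δ / 10 := by field_simp
      rw [this, div_div, div_le_iff₀ (by positivity)]
      linarith
    have hLe' : A * (4 * Real.exp (-L)) ≤ c / 50 := by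
      have h0' : 0 ≤ C₁ * Real.exp (-L) := by positivity
      have e : (A + C₁) * Real.exp (-L) = A * Real.exp (-L) + C₁ * Real.exp (-L) := by ring
      have e2 : A * (4 * Real.exp (-L)) = 4 * (A * Real.exp (-L)) := by ring
      rw [e2]; rw [e] at hLe; linarith
    have hAs : 0 ≤ A * s / M := by positivity
    have h1' := mul_le_mul_of_nonneg_left hpair hAs
    have h2' : A * s / M * (((96 * Real.exp L + 24) * R * (m₂ / Δ) + 4 * Real.exp (-L)) * M * b E
        + 3 * M * δ₀ * (⌈E / (2 * Δ)⌉₊ + ⌈E / Δ⌉₊ + 1))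
        = (A * ((96 * Real.exp L + 24) * R * (m₂ / Δ)) + A * (4 * Real.exp (-L))) * (s * b E)
          + δ₀ * (3 * A * s * (⌈E / (2 * Δ)⌉₊ + ⌈E / Δ⌉₊ + 1)) := by
      field_simp
    rw [h2'] at h1'
    have h3' := mul_le_mul_of_nonneg_right (add_le_add hΔ' hLe') hsb
    linarith
  -- (3) tail
  have T3 : C₁ * ∑ k ∈ Finset.range K, Real.sqrt (2 ^ (k + 1) * (4 * E)) * nhi (2 ^ k * (4 * E))
      ≤ c / 400 * (s * b E) + δ₀ * (C₁ * Etop ^ 2 / (2 * E * s)) := by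
    have htail := census_tail_le hb hM0 hβpos hαnn hE₀pos h4a h4b hδ₀ (Y := 4 * E) (by linarith) K
    rw [sqrt_four_mul] at htail
    set Γ₁ : ℝ := β * M * Real.exp (-(α * (4 * E))) with hΓ₁
    have hmain : Γ₁ ≤ Real.exp (-L) * (b E * E ^ 2) := by
      rw [hΓ₁, hb E]
      have h3 : Real.exp (-(α * (4 * E))) ≤ Real.exp (-L) * Real.exp (-(α * E)) := by
        rw [← Real.exp_add, Real.exp_le_exp]
        have h5 : α * E₀ ≤ α * E := mul_le_mul_of_nonneg_left hE hαnn
        have e : α * (4 * E) = 4 * (α * E) := by ring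
        rw [e]; linarith
      have h4' : β * M * Real.exp (-(α * E)) / E ^ 2 * E ^ 2 = β * M * Real.exp (-(α * E)) := by
        field_simp
      rw [h4']
      calc β * M * Real.exp (-(α * (4 * E))) ≤ β * M * (Real.exp (-L) * Real.exp (-(α * E))) :=
            mul_le_mul_of_nonneg_left h3 (by positivity)
        _ = Real.exp (-L) * (β * M * Real.exp (-(α * E))) := by ring
    have hLe' : C₁ * (Real.exp (-L) / 2) ≤ c / 400 := by
      have h0' : 0 ≤ A * Real.exp (-L) := by positivity
      have e : (A + C₁) * Real.exp (-L) = A * Real.exp (-L) + C₁ * Real.exp (-L) := by ring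
      have e2 : C₁ * (Real.exp (-L) / 2) = (C₁ * Real.exp (-L)) / 2 := by ring
      rw [e2]; rw [e] at hLe; linarith
    have e1 : 4 * (Γ₁ + δ₀ * Etop ^ 2) * (2 * s) / (4 * E) ^ 2
        = Γ₁ * s / (2 * E ^ 2) + δ₀ * (Etop ^ 2 * s / (2 * E ^ 2)) := by
      field_simp; ring
    have e2 : Γ₁ * s / (2 * E ^ 2) ≤ Real.exp (-L) / 2 * (s * b E) := by
      calc Γ₁ * s / (2 * E ^ 2) ≤ Real.exp (-L) * (b E * E ^ 2) * s / (2 * E ^ 2) :=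
            div_le_div_of_nonneg_right (mul_le_mul_of_nonneg_right hmain hs0.le) (by positivity)
        _ = Real.exp (-L) / 2 * (s * b E) := by field_simp
    have e3 : Etop ^ 2 * s / (2 * E ^ 2) = Etop ^ 2 / (2 * E * s) := by
      rw [div_eq_div_iff (by positivity) (by positivity)]
      have hs2 : s ^ 2 = E := by rw [sq, hsE]
      linear_combination (2 * Etop ^ 2 * E) * hs2
    rw [e1, e3] at htail
    have h1' := mul_le_mul_of_nonneg_left htail hC₁.le
    have h2' := mul_le_mul_of_nonneg_left e2 hC₁.le
    have h3' := mul_le_mul_of_nonneg_right hLe' hsb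
    have e4 : C₁ * (Γ₁ * s / (2 * E ^ 2) + δ₀ * (Etop ^ 2 / (2 * E * s)))
        = C₁ * (Γ₁ * s / (2 * E ^ 2)) + δ₀ * (C₁ * Etop ^ 2 / (2 * E * s)) := by ring
    have e5 : C₁ * (Real.exp (-L) / 2 * (s * b E)) = C₁ * (Real.exp (-L) / 2) * (s * b E) := by ring
    linarith
  -- (4) decay
  have T4 : 9 * c / 10 * (s * b E) - δ₀ * (2 * c * s) ≤ c * s * (nE - nhi (3 / 2 * E)) := by
    have hdec := census_decay_le hb hM0 hβpos hE₀pos hαE₀ hL hE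
    have h32 : nhi (3 / 2 * E) ≤ b (3 / 2 * E) + δ₀ := h4 _ (by linarith)
    have hd : b E - b E / 10 - 2 * δ₀ ≤ nE - nhi (3 / 2 * E) := by linarith
    have h1' := mul_le_mul_of_nonneg_left hd (show 0 ≤ c * s by positivity)
    have e : c * s * (b E - b E / 10 - 2 * δ₀) = 9 * c / 10 * (s * b E) - δ₀ * (2 * c * s) := by
      ring
    linarith
  -- (5) the `δ₀` budget
  have T5 : δ₀ * (2 * C₁ * s) + δ₀ * (3 * A * s * (⌈E / (2 * Δ)⌉₊ + ⌈E / Δ⌉₊ + 1))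
      + δ₀ * (C₁ * Etop ^ 2 / (2 * E * s)) + δ₀ * (2 * c * s) ≤ c / 2 * (s * b E) := by
    have hEtpos : 0 < Etop := by linarith
    have hs_le : s ≤ Real.sqrt Etop := Real.sqrt_le_sqrt hEt
    have hs_ge : Real.sqrt E₀ ≤ s := Real.sqrt_le_sqrt hE
    have hsE₀ : 0 < Real.sqrt E₀ := Real.sqrt_pos.2 hE₀pos
    have hK₁ : (⌈E / (2 * Δ)⌉₊ : ℝ) ≤ ⌈Etop / (2 * Δ)⌉₊ := by
      exact_mod_cast Nat.ceil_mono (div_le_div_of_nonneg_right hEt (by positivity))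
    have hJ₁ : (⌈E / Δ⌉₊ : ℝ) ≤ ⌈Etop / Δ⌉₊ := by
      exact_mod_cast Nat.ceil_mono (div_le_div_of_nonneg_right hEt hΔ0.le)
    have hT : (⌈E / (2 * Δ)⌉₊ : ℝ) + ⌈E / Δ⌉₊ + 1 ≤ ⌈Etop / (2 * Δ)⌉₊ + ⌈Etop / Δ⌉₊ + 1 := by
      linarith
    have hT0 : (0 : ℝ) ≤ ⌈E / (2 * Δ)⌉₊ + ⌈E / Δ⌉₊ + 1 := by positivity
    have hfrac : C₁ * Etop ^ 2 / (2 * E * s) ≤ C₁ * Etop ^ 2 / (2 * E₀ * Real.sqrt E₀) := by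
      apply div_le_div_of_nonneg_left (by positivity) (by positivity)
      have := mul_le_mul hE hs_ge hsE₀.le hEpos.le
      linarith
    have hbt : b Etop ≤ b E := barrier_antitone hb hβpos hM0 hαnn hEpos hEt
    have hbt0 : 0 ≤ b Etop := (barrier_pos hb hβpos hM0 hEtpos.ne').le
    have hQ : 2 * C₁ * s + 3 * A * s * (⌈E / (2 * Δ)⌉₊ + ⌈E / Δ⌉₊ + 1)
        + C₁ * Etop ^ 2 / (2 * E * s) + 2 * c * s
        ≤ 2 * C₁ * Real.sqrt Etop
          + 3 * A * Real.sqrt Etop * (⌈Etop / (2 * Δ)⌉₊ + ⌈Etop / Δ⌉₊ + 1)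
          + C₁ * Etop ^ 2 / (2 * E₀ * Real.sqrt E₀) + 2 * c * Real.sqrt Etop := by
      have a1 := mul_le_mul_of_nonneg_left hs_le (show 0 ≤ 2 * C₁ by positivity)
      have a2 : 3 * A * s * (⌈E / (2 * Δ)⌉₊ + ⌈E / Δ⌉₊ + 1)
          ≤ 3 * A * Real.sqrt Etop * (⌈Etop / (2 * Δ)⌉₊ + ⌈Etop / Δ⌉₊ + 1) := by
        apply mul_le_mul _ hT hT0 (by positivity)
        exact mul_le_mul_of_nonneg_left hs_le (by positivity)
      have a4 := mul_le_mul_of_nonneg_left hs_le (show 0 ≤ 2 * c by positivity)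
      linarith
    have h1' := mul_le_mul_of_nonneg_left hQ hδ₀
    have hr : c / 2 * Real.sqrt E₀ * b Etop ≤ c / 2 * (s * b E) := by
      have := mul_le_mul hs_ge hbt hbt0 hs0.le
      have := mul_le_mul_of_nonneg_left this (show 0 ≤ c / 2 by positivity)
      linarith [mul_assoc (c / 2) (Real.sqrt E₀) (b Etop)]
    have e : δ₀ * (2 * C₁ * s + 3 * A * s * (⌈E / (2 * Δ)⌉₊ + ⌈E / Δ⌉₊ + 1)
        + C₁ * Etop ^ 2 / (2 * E * s) + 2 * c * s)
        = δ₀ * (2 * C₁ * s) + δ₀ * (3 * A * s * (⌈E / (2 * Δ)⌉₊ + ⌈E / Δ⌉₊ + 1))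
          + δ₀ * (C₁ * Etop ^ 2 / (2 * E * s)) + δ₀ * (2 * c * s) := by ring
    linarith
  -- (6) assemble
  have hc0 : 0 ≤ c * (s * b E) := by positivity
  linarith

end Core


end Summit.AtomisticToContinuum.HydrodynamicLimit.Theorems.EnergyCurrentTailsLevelCensus

end
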